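import Summits.NavierStokesRegularity.NavierStokesRegularity.Theorems.FilamentSkeletonRssKelvinGateNeumann

/-!
# Route `FilamentSkeletonRss` · «A1R-acc» S2b-acc assembly tool — the BORDERED Neumann step in the Y-scale
# (an approximate bordered right inverse with a Y-halving defect is upgraded to an exact one)

Helper file (theorems only), `--supports stmt-NavierStokesRegularity-23611 --as helper`; LEAD of 23611, lane ns-filament-21221-p1 g13.

S2b-acc (`GateAssemblyLocAcc := WaistColumnGateLoc1A → DefectGateAcc`, vocabulary `…DefectColumnGateDefsRacc`) patches LOCAL sectional inverses (S2a-loc) and the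
free far-field resolvent into a global right inverse of the linearised profile operator BORDERED by the rate column and the `N` accretion modes.  Patching never
gives an exact inverse: it gives `𝓛(K₀F) + ∇(Q₀F) + Σ_i c_i(F)·E_i + R F = F` with a DEFECT `R` (commutators, tails) that is Y-small — `Y(RF) ≤ θ·Y(F)`, `θ ≤ ½` —
once the finitely many NON-small cokernel directions have been absorbed into the borders `c_i(F)·E_i` (R4: the waist-accretion functionals and the rate functional).
This file does the last, purely functional-analytic step once and for all on top of the landed Neumann series of this lineage (`…KelvinGateNeumann`, p606450:
`neumann_solution`, `neumann_linear` for `G = F − T G`, here with `T := −R`):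

* `borderedGate_of_approximate` — from `(K₀, Q₀, c, R)` as above (bounds `A·Y(F)`, linear on Y-bounded data, `K₀`'s outputs with any pointwise property `P`,
  e.g. divergence-free) there EXIST `(K, Q, c′)` with `𝓛(KF) + ∇(QF) + Σ_i c′_i(F)·E_i = F` EXACTLY on Y-bounded `F`, bounds `2A·Y(F)`, the property `P`, `C¹` pressure,
  and linearity — i.e. clauses (1)–(2) of `DefectGateSpecAcc` at one parameter from their approximate versions.

HONEST FRAMING: linear fixed-point bookkeeping for the gate vocabulary of a HYPOTHETICAL blow-up route (MODEL rung, negative side); nothing here bears on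
Navier–Stokes regularity; no stub is closed by this file (S2b-acc's analysis — the local inverses and the smallness of the patched defect — is the open part).
-/

set_option linter.dupNamespace false

noncomputable section

namespace Summit.NavierStokesRegularity.NavierStokesRegularity.Theorems.KelvinGate

open Set Function Filter Topology
open Literature.Analysis.FluidPDE
open scoped InnerProductSpace ContDiff Topology BigOperators

/-- **Exact bordered right inverse from an approximate one** (clauses (1)–(2) of `DefectGateSpecAcc` at one parameter).  Data: an approximate solve `(K₀, Q₀, c)`
bordered by modes `E_i` with defect `R` — `𝓛(K₀F) + ∇(Q₀F) + Σ_i c_i(F)·E_i + RF = F` on Y-bounded `F` — where `X(K₀F), |Q₀F|, |c_i F| ≤ A·Y(F)`, all linear on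
Y-bounded data, `Y(RF) ≤ θ·Y(F)` with `θ ≤ ½`, and `K₀`'s outputs have a pointwise property `P` (e.g. divergence-free) and `Q₀`'s are `C¹`.  Then there are
`(K, Q, c′)` — namely `K₀, Q₀, c` composed with the Neumann solution operator of `F′ = F + R F′` — solving EXACTLY, with constants `2A`, the property `P`, and linearity. -/
theorem borderedGate_of_approximate {M : ℕ}
    {𝓛 : (EuclideanSpace ℝ (Fin 3) → EuclideanSpace ℝ (Fin 3)) → EuclideanSpace ℝ (Fin 3) → EuclideanSpace ℝ (Fin 3)}
    {K₀ Rm : (EuclideanSpace ℝ (Fin 3) → EuclideanSpace ℝ (Fin 3)) → EuclideanSpace ℝ (Fin 3) → EuclideanSpace ℝ (Fin 3)}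
    {Q₀ : (EuclideanSpace ℝ (Fin 3) → EuclideanSpace ℝ (Fin 3)) → EuclideanSpace ℝ (Fin 3) → ℝ}
    {c : (EuclideanSpace ℝ (Fin 3) → EuclideanSpace ℝ (Fin 3)) → Fin M → ℝ} {E : Fin M → EuclideanSpace ℝ (Fin 3) → EuclideanSpace ℝ (Fin 3)} {A θ : ℝ}
    {P : (EuclideanSpace ℝ (Fin 3) → EuclideanSpace ℝ (Fin 3)) → Prop}
    (hK1 : ∀ (F : EuclideanSpace ℝ (Fin 3) → EuclideanSpace ℝ (Fin 3)) (S : ℝ), YBound F S →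
      XBound (K₀ F) (A * S) ∧ ContDiff ℝ 1 (Q₀ F) ∧ (∀ y, |Q₀ F y| ≤ A * S) ∧ (∀ i, |c F i| ≤ A * S) ∧ P (K₀ F) ∧
      ∀ y, 𝓛 (K₀ F) y + gradient (Q₀ F) y + ∑ i, c F i • E i y + Rm F y = F y)
    (hK2 : ∀ (F G : EuclideanSpace ℝ (Fin 3) → EuclideanSpace ℝ (Fin 3)) (s : ℝ), (∃ S, YBound F S) → (∃ S, YBound G S) →
      (K₀ (fun y => F y + s • G y) = fun y => K₀ F y + s • K₀ G y) ∧ (∀ i, c (fun y => F y + s • G y) i = c F i + s * c G i))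
    (hR1 : ∀ (G : EuclideanSpace ℝ (Fin 3) → EuclideanSpace ℝ (Fin 3)) (S : ℝ), YBound G S → YBound (Rm G) (θ * S))
    (hR2 : ∀ (F G : EuclideanSpace ℝ (Fin 3) → EuclideanSpace ℝ (Fin 3)) (s : ℝ), (∃ S, YBound F S) → (∃ S, YBound G S) →
      Rm (fun y => F y + s • G y) = fun y => Rm F y + s • Rm G y)
    (hθ : θ ≤ 1 / 2) :
    ∃ (K : (EuclideanSpace ℝ (Fin 3) → EuclideanSpace ℝ (Fin 3)) → EuclideanSpace ℝ (Fin 3) → EuclideanSpace ℝ (Fin 3))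
      (Q : (EuclideanSpace ℝ (Fin 3) → EuclideanSpace ℝ (Fin 3)) → EuclideanSpace ℝ (Fin 3) → ℝ)
      (c' : (EuclideanSpace ℝ (Fin 3) → EuclideanSpace ℝ (Fin 3)) → Fin M → ℝ),
    (∀ (F : EuclideanSpace ℝ (Fin 3) → EuclideanSpace ℝ (Fin 3)) (S : ℝ), YBound F S →
      XBound (K F) (2 * A * S) ∧ ContDiff ℝ 1 (Q F) ∧ (∀ y, |Q F y| ≤ 2 * A * S) ∧ (∀ i, |c' F i| ≤ 2 * A * S) ∧ P (K F) ∧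
      ∀ y, 𝓛 (K F) y + gradient (Q F) y + ∑ i, c' F i • E i y = F y) ∧
    (∀ (F G : EuclideanSpace ℝ (Fin 3) → EuclideanSpace ℝ (Fin 3)) (s : ℝ), (∃ S, YBound F S) → (∃ S, YBound G S) →
      (K (fun y => F y + s • G y) = fun y => K F y + s • K G y) ∧ (∀ i, c' (fun y => F y + s • G y) i = c' F i + s * c' G i)) := by
  -- the Neumann operator of `F′ = F − T F′` with `T := −R`
  set T : (EuclideanSpace ℝ (Fin 3) → EuclideanSpace ℝ (Fin 3)) → EuclideanSpace ℝ (Fin 3) → EuclideanSpace ℝ (Fin 3) :=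
    fun G y => -Rm G y with hT
  have hT1 : ∀ (G : EuclideanSpace ℝ (Fin 3) → EuclideanSpace ℝ (Fin 3)) (S : ℝ), YBound G S → YBound (T G) (θ * S) :=
    fun G S hG => (hR1 G S hG).neg
  have hT2 : ∀ (G H : EuclideanSpace ℝ (Fin 3) → EuclideanSpace ℝ (Fin 3)) (s : ℝ), (∃ S, YBound G S) → (∃ S, YBound H S) →
      T (fun y => G y + s • H y) = fun y => T G y + s • T H y := by
    intro G H s hG hH
    have h := hR2 G H s hG hH
    funext y
    show -Rm (fun y => G y + s • H y) y = -Rm G y + s • -Rm H y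
    rw [h]; simp only [smul_neg]; abel
  choose Sop hS1 hS2 using fun F => neumann_solution hT1 hT2 hθ F
  have hSlin := neumann_linear hT1 hT2 hθ (S := Sop) (fun F R hF => hS1 F R hF) (fun F R hF => hS2 F R hF)
  refine ⟨fun F => K₀ (Sop F), fun F => Q₀ (Sop F), fun F => c (Sop F), fun F S hF => ?_, fun F G s hF hG => ?_⟩
  · have hSF : YBound (Sop F) (2 * S) := hS1 F S hF
    obtain ⟨hX, hQ1, hQb, hcb, hP, hid⟩ := hK1 _ _ hSF
    refine ⟨hX.mono (le_of_eq (by ring)), hQ1, fun y => (hQb y).trans (le_of_eq (by ring)), fun i => (hcb i).trans (le_of_eq (by ring)), hP,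
      fun y => ?_⟩
    have h := hid y
    have e : Sop F y = F y - T (Sop F) y := hS2 F S hF y
    have e' : Sop F y = F y + Rm (Sop F) y := by rw [e]; show F y - -Rm (Sop F) y = F y + Rm (Sop F) y; abel
    rw [e'] at h
    exact add_right_cancel h
  · have hlin := hSlin F G s hF hG
    obtain ⟨S, hFS⟩ := hF
    obtain ⟨S', hGS⟩ := hG
    have hNF : YBound (Sop F) (2 * S) := hS1 F S hFS
    have hNG : YBound (Sop G) (2 * S') := hS1 G S' hGS
    show (K₀ (Sop (fun y => F y + s • G y)) = fun y => K₀ (Sop F) y + s • K₀ (Sop G) y) ∧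
      ∀ i, c (Sop (fun y => F y + s • G y)) i = c (Sop F) i + s * c (Sop G) i
    rw [hlin]
    exact hK2 _ _ s ⟨_, hNF⟩ ⟨_, hNG⟩

end Summit.NavierStokesRegularity.NavierStokesRegularity.Theorems.KelvinGate

end
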